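import Literature.MathematicalPhysics.QuantumLattice.KohnLuttingerChannelStates
import Literature.MathematicalPhysics.QuantumLattice.SquareBandHighSymmetryIdentities
import HarnessLib

/-!
# Hot spots of the `t–t′` band and the `Q`-parity of gap harmonics

Topic `Literature/MathematicalPhysics/QuantumLattice`; continues `KohnLuttingerChannelStates` (channels, `D₄`
action) and `SquareBandHighSymmetryIdentities` (the constructor `mom a b`).  Exact, interaction-free band
geometry behind the "hot-spot" language of weak-coupling pairing on the square lattice:

* `nestingVectorQ = (π, π)` and the **nesting-defect identity**
  `squareDispersion_nestingQ_sub_sub : ε_{t,t′}(Q − k) − ε_{t,t′}(k) = 4t (cos k₀ + cos k₁)` — the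
  next-nearest-neighbour term is `Q`-symmetric, so the defect does NOT depend on `t′`;
* hence a pair `(k, Q − k)` lies on ONE level set iff `k` is on the magnetic zone boundary
  `cos k₀ + cos k₁ = 0` (`squareDispersion_nestingQ_sub_eq_iff`), where the band energy is `4t′ cos² k₀`
  (`squareDispersion_of_mem_zoneBoundary`); so a level `μ` carries such a point only if `μ ∈ [4t′, 0]`
  (`mem_Icc_of_hotSpot`, `t′ ≤ 0`) and, conversely, every `μ ∈ [4t′, 0]` does (`exists_hotSpot`, `t′ < 0`,
  witness `(a, a − π)` with `cos a = √(μ/4t′)`): `exists_hotSpot_iff`.  The two ends of the interval are the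
  van Hove level `μ = 4t′` (hot spots merge into the saddles) and `μ = 0` (they merge on the zone diagonal);
* the **`Q`-parity of the lowest harmonics** under the hot-spot map `k ↦ Q − k`:
  `sin(k₀ − k₁)` and `cos k₀ − cos k₁` are `Q`-odd, `sin k₀` is `Q`-even
  (`sin_sub_nestingQ_sub`, `dWave_nestingQ_sub`, `sin_nestingQ_sub_apply_zero`), so on a hot-spot pair the
  products `ψ(k) ψ(Q − k)` are `≤ 0` for the first two (a positive kernel peaked at transfer `Q` is
  ATTRACTIVE for them) and `≥ 0` for the nearest-neighbour p-wave (repulsive):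
  `sin_sub_mul_nestingQ_nonpos`, `sin_mul_nestingQ_nonneg`; `sin(k₀ − k₁)` is an `E`-channel function
  (`inChannel_E_sin_sub`), odd under the diagonal mirror `s r³ : (k₀, k₁) ↦ (k₁, k₀)`
  (`sin_sub_diagMirror`), which IS the hot-spot map on the zone-boundary edges `k₀ + k₁ = π`
  (`nestingQ_sub_eq_diagMirror_of_edge`), and it vanishes on the anti-diagonal edges `k₀ − k₁ = ±π`
  (`sin_sub_eq_zero_of_antidiag_edge`);
* **odd gap functions vanish at the type-I saddles**: an odd, `2π`-periodic `ψ` has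
  `ψ(−π, 0) = ψ(0, −π) = 0` (`odd_periodic_apply_saddleX/Y_eq_zero`) — the zone representatives of the van
  Hove points `(π, 0)`, `(0, π)` are time-reversal-invariant momenta.

Sources: the hot-spot / nesting language and the van Hove level `μ = 4t′` of the `t–t′` band are standard
(Raghu–Kivelson–Scalapino, Phys. Rev. B 81 (2010) 224505, §III, arXiv:1002.0591; Šimkovic–Deng–Kozik–
Prokof'ev–Svistunov, Phys. Rev. B 94 (2016) 085106, §3, arXiv:1512.04271); the sign criterion
`ψ(k + Q) = −ψ(k)` for pairing by a kernel peaked at `Q` is folklore (triplet form: Kuwabara–Ogata,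
Phys. Rev. Lett. 85 (2000) 4586).  Everything here is an elementary identity and is proved; tagged [folklore].
Deliberately NOT here: any statement about `lindhardFunction`, `pairingForm` or `channelInf` (the conjectural
"odd-parity hot-spot law" of cell gate-hubbard-kl lives in the crux card on `stmt-HubbardSuperconductivity-0158`,
not in Literature).  AI-produced formalisation (H21, cell gate-hubbard-kl, seat hubbard-klscan-idea-1 g3, 2026-08-28).
-/

noncomputable section

open Real

namespace Literature.MathematicalPhysics.QuantumLattice

/-! ### The nesting vector and the nesting defect -/

/-- The antiferromagnetic nesting vector `Q = (π, π)`. [folklore] -/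
def nestingVectorQ : Momentum := mom π π

/-- `Q₀ = π`. [cite: RaghuKivelsonScalapino2010, §III] -/
@[simp] theorem nestingVectorQ_apply_zero : nestingVectorQ 0 = π := by
  simp [nestingVectorQ]

/-- `Q₁ = π`. [cite: RaghuKivelsonScalapino2010, §III] -/
@[simp] theorem nestingVectorQ_apply_one : nestingVectorQ 1 = π := by
  simp [nestingVectorQ]

/-- **Nesting-defect identity.** `ε_{t,t′}(Q − k) − ε_{t,t′}(k) = 4t (cos k₀ + cos k₁)`: the `t′` term
`−4t′ cos k₀ cos k₁` is invariant under `k ↦ Q − k`, so the defect is `t′`-independent. [cite: RaghuKivelsonScalapino2010, §III] -/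
theorem squareDispersion_nestingQ_sub_sub (t t' : ℝ) (k : Momentum) :
    squareDispersion t t' (nestingVectorQ - k) - squareDispersion t t' k
      = 4 * t * (cos (k 0) + cos (k 1)) := by
  simp only [squareDispersion, PiLp.sub_apply, nestingVectorQ_apply_zero, nestingVectorQ_apply_one,
    Real.cos_pi_sub]
  ring

/-- A pair `(k, Q − k)` lies on one level set of the `t–t′` band (`t ≠ 0`) iff `k` is on the magnetic
zone boundary `cos k₀ + cos k₁ = 0`. [cite: RaghuKivelsonScalapino2010, §III] -/
theorem squareDispersion_nestingQ_sub_eq_iff (t t' μ : ℝ) (ht : t ≠ 0) (k : Momentum)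
    (hk : squareDispersion t t' k = μ) :
    squareDispersion t t' (nestingVectorQ - k) = μ ↔ cos (k 0) + cos (k 1) = 0 := by
  have h := squareDispersion_nestingQ_sub_sub t t' k
  constructor
  · intro h2
    have h4 : 4 * t * (cos (k 0) + cos (k 1)) = 0 := by linarith
    rcases mul_eq_zero.mp h4 with h4 | h4
    · exact absurd (by linarith : t = 0) ht
    · exact h4
  · intro h0
    rw [h0] at h
    linarith

/-- On the magnetic zone boundary the band energy is `4t′ cos² k₀`, whatever `t`. [cite: RaghuKivelsonScalapino2010, §III] -/
theorem squareDispersion_of_mem_zoneBoundary (t t' : ℝ) (k : Momentum)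
    (h : cos (k 0) + cos (k 1) = 0) :
    squareDispersion t t' k = 4 * t' * cos (k 0) ^ 2 := by
  have h1 : cos (k 1) = -cos (k 0) := by linarith
  simp only [squareDispersion, h1]
  ring

/-! ### The hot-spot interval `[4t′, 0]` -/

/-- **Hot spots force `μ ∈ [4t′, 0]`.** If `t′ ≤ 0` and the level `μ` of the `t–t′` band carries a
zone-boundary point, then `4t′ ≤ μ ≤ 0`; in particular for `μ < 4t′` (beyond the van Hove crossing, `t′ < 0`)
the Fermi curve has no hot spots. [cite: RaghuKivelsonScalapino2010, §III] -/
theorem mem_Icc_of_hotSpot (t t' μ : ℝ) (ht' : t' ≤ 0) (k : Momentum)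
    (hmzb : cos (k 0) + cos (k 1) = 0) (hk : squareDispersion t t' k = μ) :
    μ ∈ Set.Icc (4 * t') 0 := by
  rw [squareDispersion_of_mem_zoneBoundary t t' k hmzb] at hk
  have hc1 : cos (k 0) ^ 2 ≤ 1 := Real.cos_sq_le_one (k 0)
  have hc0 : 0 ≤ cos (k 0) ^ 2 := sq_nonneg _
  constructor <;> nlinarith

/-- **Every level `μ ∈ [4t′, 0]` (`t′ < 0`) has a hot spot on its Fermi curve**, namely the zone point
`(a, a − π)` with `cos a = √(μ/4t′)`, `a ∈ [0, π/2]`. [cite: RaghuKivelsonScalapino2010, §III] -/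
theorem exists_hotSpot (t t' μ : ℝ) (ht' : t' < 0) (hμ : μ ∈ Set.Icc (4 * t') 0) :
    ∃ k ∈ fermiCurve (squareDispersion t t') μ, cos (k 0) + cos (k 1) = 0 := by
  have h4 : 4 * t' < 0 := by linarith
  have hq0 : 0 ≤ μ / (4 * t') := div_nonneg_of_nonpos hμ.2 h4.le
  have hq1 : μ / (4 * t') ≤ 1 := (div_le_one_of_neg h4).2 hμ.1
  set c : ℝ := Real.sqrt (μ / (4 * t')) with hc
  have hc0 : 0 ≤ c := Real.sqrt_nonneg _
  have hc1 : c ≤ 1 := by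
    rw [hc]
    calc Real.sqrt (μ / (4 * t')) ≤ Real.sqrt 1 := Real.sqrt_le_sqrt hq1
      _ = 1 := Real.sqrt_one
  have hcsq : c ^ 2 = μ / (4 * t') := by rw [hc]; exact Real.sq_sqrt hq0
  set a : ℝ := Real.arccos c with ha
  have hcos : cos a = c := Real.cos_arccos (by linarith) hc1
  have ha0 : 0 ≤ a := Real.arccos_nonneg c
  have haπ2 : a ≤ π / 2 := Real.arccos_le_pi_div_two.2 hc0
  refine ⟨mom a (a - π), ⟨?_, ?_⟩, ?_⟩
  · intro i
    fin_cases i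
    · simp only [Fin.zero_eta, mom_apply_zero, Set.mem_Ico]
      constructor <;> linarith [Real.pi_pos]
    · simp only [Fin.mk_one, mom_apply_one, Set.mem_Ico]
      constructor <;> linarith [Real.pi_pos]
  · simp only [squareDispersion, mom_apply_zero, mom_apply_one, Real.cos_sub_pi, hcos]
    have ht0 : t' ≠ 0 := ht'.ne
    have : 4 * t' * c ^ 2 = μ := by
      rw [hcsq]; field_simp
    nlinarith [this]
  · simp only [mom_apply_zero, mom_apply_one, Real.cos_sub_pi]
    ring

/-- **The hot-spot interval.** For `t′ < 0` the Fermi curve of the `t–t′` band at level `μ` meets the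
magnetic zone boundary iff `4t′ ≤ μ ≤ 0`. [cite: RaghuKivelsonScalapino2010, §III] -/
theorem exists_hotSpot_iff (t t' μ : ℝ) (ht' : t' < 0) :
    (∃ k ∈ fermiCurve (squareDispersion t t') μ, cos (k 0) + cos (k 1) = 0)
      ↔ μ ∈ Set.Icc (4 * t') 0 := by
  constructor
  · rintro ⟨k, hk, hmzb⟩
    exact mem_Icc_of_hotSpot t t' μ ht'.le k hmzb hk.2
  · exact exists_hotSpot t t' μ ht'

/-! ### The `Q`-parity of the lowest gap harmonics -/

/-- `sin(k₀ − k₁)` is `Q`-ODD: `sin((Q−k)₀ − (Q−k)₁) = −sin(k₀ − k₁)`. [cite: RaghuKivelsonScalapino2010, §III] -/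
theorem sin_sub_nestingQ_sub (k : Momentum) :
    sin ((nestingVectorQ - k) 0 - (nestingVectorQ - k) 1) = -sin (k 0 - k 1) := by
  simp only [PiLp.sub_apply, nestingVectorQ_apply_zero, nestingVectorQ_apply_one]
  rw [show π - k 0 - (π - k 1) = -(k 0 - k 1) by ring, Real.sin_neg]

/-- The nearest-neighbour p-wave `sin k₀` is `Q`-EVEN: `sin (Q−k)₀ = sin k₀`. [cite: RaghuKivelsonScalapino2010, §III] -/
theorem sin_nestingQ_sub_apply_zero (k : Momentum) : sin ((nestingVectorQ - k) 0) = sin (k 0) := by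
  simp [PiLp.sub_apply, Real.sin_pi_sub]

/-- `cos k₀ − cos k₁` (`d_{x²−y²}`) is `Q`-odd. [cite: RaghuKivelsonScalapino2010, §III] -/
theorem dWave_nestingQ_sub (k : Momentum) :
    cos ((nestingVectorQ - k) 0) - cos ((nestingVectorQ - k) 1) = -(cos (k 0) - cos (k 1)) := by
  simp only [PiLp.sub_apply, nestingVectorQ_apply_zero, nestingVectorQ_apply_one, Real.cos_pi_sub]
  ring

/-- On a hot-spot pair the product of the `Q`-odd harmonic `sin(k₀ − k₁)` is `≤ 0` (a positive kernel
peaked at transfer `Q` enters its pairing form with the attractive sign). [cite: RaghuKivelsonScalapino2010, §III] -/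
theorem sin_sub_mul_nestingQ_nonpos (k : Momentum) :
    sin (k 0 - k 1) * sin ((nestingVectorQ - k) 0 - (nestingVectorQ - k) 1) ≤ 0 := by
  rw [sin_sub_nestingQ_sub]
  nlinarith [sq_nonneg (sin (k 0 - k 1))]

/-- … while for the `Q`-even nearest-neighbour p-wave the product is `≥ 0` (repulsive). [cite: RaghuKivelsonScalapino2010, §III] -/
theorem sin_mul_nestingQ_nonneg (k : Momentum) :
    0 ≤ sin (k 0) * sin ((nestingVectorQ - k) 0) := by
  rw [sin_nestingQ_sub_apply_zero]
  exact mul_self_nonneg _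

/-- `sin(k₀ − k₁)` is odd, hence an `E`-channel gap function. [cite: RaghuKivelsonScalapino2010, §III] -/
theorem inChannel_E_sin_sub : InChannel .E (fun k : Momentum => sin (k 0 - k 1)) := by
  rw [inChannel_E_iff_odd]
  intro k
  simp only [PiLp.neg_apply]
  rw [show -k 0 - -k 1 = -(k 0 - k 1) by ring, Real.sin_neg]

/-- `sin(k₀ − k₁)` is odd under the diagonal mirror `s r³ : (k₀, k₁) ↦ (k₁, k₀)`. [cite: RaghuKivelsonScalapino2010, §III] -/
theorem sin_sub_diagMirror (k : Momentum) :
    sin ((d4Momentum (.sr 3) k) 0 - (d4Momentum (.sr 3) k) 1) = -sin (k 0 - k 1) := by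
  simp only [d4Momentum_sr_three, reflMomentum_apply_zero, reflMomentum_apply_one,
    rotMomentum_apply_zero, rotMomentum_apply_one, neg_neg]
  rw [show k 1 - k 0 = -(k 0 - k 1) by ring, Real.sin_neg]

/-- On the zone-boundary edges `k₀ + k₁ = π` the hot-spot partner IS the diagonal mirror image:
`Q − k = s r³ k`. [cite: RaghuKivelsonScalapino2010, §III] -/
theorem nestingQ_sub_eq_diagMirror_of_edge (k : Momentum) (h : k 0 + k 1 = π) :
    nestingVectorQ - k = d4Momentum (.sr 3) k := by
  ext i
  fin_cases i
  · simp only [Fin.zero_eta, PiLp.sub_apply, nestingVectorQ_apply_zero, d4Momentum_sr_three,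
      reflMomentum_apply_zero, rotMomentum_apply_zero, rotMomentum_apply_one, neg_neg]
    linarith
  · simp only [Fin.mk_one, PiLp.sub_apply, nestingVectorQ_apply_one, d4Momentum_sr_three,
      reflMomentum_apply_one, rotMomentum_apply_zero, rotMomentum_apply_one, neg_neg]
    linarith

/-- On the anti-diagonal zone-boundary edges `k₀ − k₁ = ±π` the harmonic `sin(k₀ − k₁)` vanishes.
[cite: RaghuKivelsonScalapino2010, §III] -/
theorem sin_sub_eq_zero_of_antidiag_edge (k : Momentum) (h : k 0 - k 1 = π ∨ k 0 - k 1 = -π) :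
    sin (k 0 - k 1) = 0 := by
  rcases h with h | h
  · simp [h]
  · simp [h, Real.sin_neg]

/-- On the diagonal edges `k₀ + k₁ = π` it reads `sin(k₀ − k₁) = −sin(2k₀)`. [cite: RaghuKivelsonScalapino2010, §III] -/
theorem sin_sub_of_diag_edge (k : Momentum) (h : k 0 + k 1 = π) : sin (k 0 - k 1) = -sin (2 * k 0) := by
  have h1 : k 1 = π - k 0 := by linarith
  rw [h1, show k 0 - (π - k 0) = 2 * k 0 - π by ring, Real.sin_sub_pi]

/-! ### Odd gap functions vanish at the type-I saddles -/

/-- **An odd, `2π`-periodic (in `k₀`) function vanishes at the saddle `(−π, 0)`** (the zone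
representative of the van Hove point `(π, 0)`): `ψ(−s) = −ψ(s)` while `−s = s + 2π e₀`. [cite: RaghuKivelsonScalapino2010, §III] -/
theorem odd_periodic_apply_saddleX_eq_zero (ψ : Momentum → ℝ) (hodd : ∀ k, ψ (-k) = -ψ k)
    (hper : ∀ k, ψ (k + mom (2 * π) 0) = ψ k) : ψ (mom (-π) 0) = 0 := by
  have hneg : -mom (-π) 0 = mom (-π) 0 + mom (2 * π) 0 := by
    ext i
    fin_cases i
    · simp only [Fin.zero_eta, PiLp.neg_apply, PiLp.add_apply, mom_apply_zero]
      ring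
    · simp only [Fin.mk_one, PiLp.neg_apply, PiLp.add_apply, mom_apply_one]
      ring
  have h1 : ψ (-mom (-π) 0) = ψ (mom (-π) 0) := by rw [hneg, hper]
  have h2 : ψ (-mom (-π) 0) = -ψ (mom (-π) 0) := hodd _
  linarith

/-- Same at the saddle `(0, −π)` for a function `2π`-periodic in `k₁`. [cite: RaghuKivelsonScalapino2010, §III] -/
theorem odd_periodic_apply_saddleY_eq_zero (ψ : Momentum → ℝ) (hodd : ∀ k, ψ (-k) = -ψ k)
    (hper : ∀ k, ψ (k + mom 0 (2 * π)) = ψ k) : ψ (mom 0 (-π)) = 0 := by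
  have hneg : -mom 0 (-π) = mom 0 (-π) + mom 0 (2 * π) := by
    ext i
    fin_cases i
    · simp only [Fin.zero_eta, PiLp.neg_apply, PiLp.add_apply, mom_apply_zero]
      ring
    · simp only [Fin.mk_one, PiLp.neg_apply, PiLp.add_apply, mom_apply_one]
      ring
  have h1 : ψ (-mom 0 (-π)) = ψ (mom 0 (-π)) := by rw [hneg, hper]
  have h2 : ψ (-mom 0 (-π)) = -ψ (mom 0 (-π)) := hodd _
  linarith

/-- For the record: `sin(k₀ − k₁)` at the two saddles. [cite: RaghuKivelsonScalapino2010, §III] -/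
theorem sin_sub_saddles :
    sin ((mom (-π) 0) 0 - (mom (-π) 0) 1) = 0 ∧ sin ((mom 0 (-π)) 0 - (mom 0 (-π)) 1) = 0 := by
  constructor <;> simp

end Literature.MathematicalPhysics.QuantumLattice

end
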